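import Summits.NavierStokesRegularity.NavierStokesRegularity.Theorems.AdaptedFrequencyConverges.Negative.FalseWithoutDecay
import Literature.Analysis.FluidPDE.AdaptedBackwardKernel

/-!
# The ACTIVE stubs of line `tauberian-omega-limit` against the linear witness — addendum

Negative-side support for crux `AdaptedFrequencyConverges` (stmt-NavierStokesRegularity-10493, route
`AdaptedFrequency`), cdisprove seat, cycle 2 (2026-08-16).  Complements the drefute file
`…Negative.TauberianStubsWithoutDecay` (which refutes, without the far-field hypotheses, the two-sided
`stub_pinching` of the first skeleton and `stub_slowDecrease` with `ε = 1/4`) for the lead's ACTIVE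
skeleton (sha 1b56b576…: `stub_kernelCalculus`, `stub_pinchingUpper` [landed], `stub_pinchingLower`
[landed, via Barker–Prange `L³` concentration — a far-field input], `stub_slowDecrease`, `stub_landau`
[landed]):

* `stub_pinchingUpper_witness`: the witness SATISFIES the upper pinching (`C₁ = e²`) — far-field blind;
* `stub_pinchingLower_false_without_decay`: the one-sided ACTIVE `stub_pinchingLower` is false without the
  far-field hypotheses (`(1−t)² H → 0`) — consistent with, and explaining, the far-field input
  (Morrey bound + `L³` concentration) in its landed proof;
* `two_cos_log_window`, `not_slowlyDecreasing_two_cos_log`: the sharper window — `2cos log(1−t)` drops by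
  `4 sin(1/3) > 1` (not just `0.45`) across `[1 − e^{−(π/2−1/3+2πn)}, 1 − e^{−(π/2+1/3+2πn)}]`
  (log-length `2/3 ≤ log 2`), so slow decrease fails with `ε = 1`;
* (in the sibling `…Negative.SlowDecreaseSmall`: no smallness threshold rescues `stub_slowDecrease` without a
  far-field input — the δ-small strengthening is false on the ε-flow of `…Negative.SmallOscillation`.)

The three witness computations `adaptedEnstrophy_vel'`, `sq_mul_adaptedEnstrophy_vel_le'`,
`tendsto_sq_mul_adaptedEnstrophy_vel'` are PRIVATE copies of the drefute file's lemmas (that module is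
imported by nothing and had no farm olean when this file was verified; one FQN, one module).
-/

noncomputable section

namespace Summit.NavierStokesRegularity.NavierStokesRegularity.Theorems.AdaptedFrequencyConverges.Negative

open scoped Topology
open Literature.Analysis.FluidPDE Set Filter MeasureTheory Real

/-! ## The witness in the vocabulary of the line -/

/-- (private copy of `…TauberianStubsWithoutDecay.adaptedEnstrophy_vel`) the adapted enstrophy of the
witness is `ω(t)²`. [folklore] -/
private theorem adaptedEnstrophy_vel' {ν : ℝ} (hν : 0 < ν) {t : ℝ} (ht : t < 1) :
    adaptedEnstrophy vel (G ν) t = amp t ^ 2 := by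
  rw [adaptedEnstrophy_apply]
  exact integral_curl_vel_sq_mul_G hν ht

/-- (private copy) `(1−t)² H(t) ≤ (1−t)² e²` for the witness. [folklore] -/
private theorem sq_mul_adaptedEnstrophy_vel_le' {ν : ℝ} (hν : 0 < ν) {t : ℝ} (ht : t < 1) :
    (1 - t) ^ 2 * adaptedEnstrophy vel (G ν) t ≤ (1 - t) ^ 2 * Real.exp 2 := by
  rw [adaptedEnstrophy_vel' hν ht]
  refine mul_le_mul_of_nonneg_left ?_ (sq_nonneg _)
  calc amp t ^ 2 ≤ Real.exp 1 ^ 2 := pow_le_pow_left₀ (amp_pos t).le (amp_le t) 2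
    _ = Real.exp 2 := by rw [← Real.exp_nat_mul]; norm_num

/-- (private copy) `(1−t)² H(t) → 0` for the witness. [folklore] -/
private theorem tendsto_sq_mul_adaptedEnstrophy_vel' {ν : ℝ} (hν : 0 < ν) :
    Tendsto (fun t => (1 - t) ^ 2 * adaptedEnstrophy vel (G ν) t) (𝓝[<] 1) (𝓝 0) := by
  have h0 : Tendsto (fun t : ℝ => (1 - t) ^ 2 * Real.exp 2) (𝓝[<] 1) (𝓝 0) := by
    have hc : Continuous (fun t : ℝ => (1 - t) ^ 2 * Real.exp 2) := by fun_prop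
    have h1 := hc.tendsto 1
    simp only [sub_self, ne_eq, OfNat.ofNat_ne_zero, not_false_eq_true, zero_pow, zero_mul] at h1
    exact h1.mono_left nhdsWithin_le_nhds
  refine tendsto_of_tendsto_of_tendsto_of_le_of_le' tendsto_const_nhds h0 ?_ ?_
  · filter_upwards [self_mem_nhdsWithin] with t ht
    exact mul_nonneg (sq_nonneg _) (adaptedEnstrophy_nonneg fun x => (G_pos hν ht x).le)
  · filter_upwards [self_mem_nhdsWithin] with t ht
    exact sq_mul_adaptedEnstrophy_vel_le' hν ht


/-- The exact kernel of the witness is an adapted backward kernel on `[0,1)` with pole `(1,0)`. [folklore] -/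
theorem isAdaptedBackwardKernel_G {ν : ℝ} (hν : 0 < ν) :
    IsAdaptedBackwardKernel ν vel (Ico 0 1) 1 0 (G ν) :=
  isAdaptedBackwardKernel_iff.2 (kernel_clauses hν)

/-- The exact kernel of the witness is two-sided Gaussian-comparable. [folklore] -/
theorem isGaussianComparable_G {ν : ℝ} (hν : 0 < ν) :
    IsGaussianComparable (G ν) (Ico 0 1) 1 0 :=
  isGaussianComparable_iff_fin_three.2 (G_comparable hν)

/-! ## `stub_pinchingUpper` holds on the witness; `stub_pinchingLower` fails on it -/

/-- The witness satisfies the conclusion of `stub_pinchingUpper` (with `t₁ = 0`, `C₁ = e²`): the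
upper pinching is blind to the far field. [folklore] -/
theorem stub_pinchingUpper_witness {ν : ℝ} (hν : 0 < ν) :
    ∃ t₁ ∈ Ico (0:ℝ) 1, ∃ C₁ : ℝ, ∀ t ∈ Ico t₁ 1,
      (1 - t) ^ 2 * adaptedEnstrophy vel (G ν) t ≤ C₁ := by
  refine ⟨0, ⟨le_rfl, one_pos⟩, Real.exp 2, fun t ht => (sq_mul_adaptedEnstrophy_vel_le' hν ht.2).trans ?_⟩
  have h1 : (1 - t) ^ 2 ≤ 1 := by nlinarith [ht.1, ht.2]
  calc (1 - t) ^ 2 * Real.exp 2 ≤ 1 * Real.exp 2 := by gcongr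
    _ = Real.exp 2 := one_mul _

/-- **`stub_pinchingLower` is false without the far-field hypotheses.**  The negated statement is
the lead's `stub_pinchingLower` (skeleton 1b56b576…) with `IsLerayHopfOn`, `HasRapidSpatialDecay`
DROPPED and `IsTypeIBlowup u T` WEAKENED to the parabolic-local Type-I bound at `x₀`; the classical
NS system, the backward singularity at `(T,x₀)`, `IsAdaptedBackwardKernel`, `IsGaussianComparable`
are kept verbatim.  Witness: the linear flow, for which `(1−t)² H(t) → 0`.  Hence the lower pinching
is the FAR-FIELD step of line `tauberian-omega-limit`. [folklore] -/
theorem stub_pinchingLower_false_without_decay :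
    ¬ (∀ (ν T : ℝ) (u : ℝ → EuclideanSpace ℝ (Fin 3) → EuclideanSpace ℝ (Fin 3))
        (p : ℝ → EuclideanSpace ℝ (Fin 3) → ℝ) (x₀ : EuclideanSpace ℝ (Fin 3)) (t₀ : ℝ)
        (G : ℝ → EuclideanSpace ℝ (Fin 3) → ℝ), 0 < ν → 0 < T →
        IsClassicalNSSolutionOn (Ico 0 T) ν 0 u p →
        (∃ C : ℝ, ∀ᶠ t in 𝓝[<] T, ∀ x, ‖x - x₀‖ ^ 2 ≤ T - t → ‖u t x‖ ≤ C / Real.sqrt (T - t)) →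
        t₀ ∈ Ico 0 T →
        (∀ r : ℝ, 0 < r → eLpNorm (Function.uncurry u) ⊤
          (volume.restrict (parabolicCylinder r (T, x₀))) = ⊤) →
        IsAdaptedBackwardKernel ν u (Ico t₀ T) T x₀ G → IsGaussianComparable G (Ico t₀ T) T x₀ →
        ∃ t₁ ∈ Ico t₀ T, ∃ c₀ : ℝ, 0 < c₀ ∧ ∀ t ∈ Ico t₁ T, c₀ ≤ (T - t) ^ 2 * adaptedEnstrophy u G t) := by
  intro h
  obtain ⟨t₁, ht₁, c₀, hc₀, hle⟩ := h 1 1 vel pres 0 0 (G 1) one_pos one_pos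
    (isClassicalNSSolutionOn_vel 1) local_typeI_vel ⟨le_rfl, one_pos⟩ singular_vel
    (isAdaptedBackwardKernel_G one_pos) (isGaussianComparable_G one_pos)
  have hev1 : ∀ᶠ t in 𝓝[<] (1:ℝ), (1 - t) ^ 2 * adaptedEnstrophy vel (G 1) t < c₀ :=
    (tendsto_sq_mul_adaptedEnstrophy_vel' one_pos).eventually (Iio_mem_nhds hc₀)
  have hev2 : ∀ᶠ t in 𝓝[<] (1:ℝ), t ∈ Ico t₁ 1 := Ico_mem_nhdsLT ht₁.2
  obtain ⟨t, ht, ht'⟩ := (hev1.and hev2).exists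
  exact lt_irrefl c₀ ((hle t ht').trans_lt ht)

/-! ## `stub_slowDecrease` fails on the witness -/

/-- One dyadic window on which `2 cos log(1−t)` drops by more than `1`: from
`t = 1 − e^{−a}` to `t' = 1 − e^{−(a + 2/3)}`, `a = π/2 − 1/3 + 2πn`, the values are `2 sin(1/3)`
and `−2 sin(1/3)`, and `4 sin(1/3) > 1`; the window is dyadic because `2/3 ≤ log 2`. [folklore] -/
theorem two_cos_log_window (n : ℕ) :
    1 - Real.exp (-(π / 2 - 1 / 3 + n * (2 * π))) ≤ 1 - Real.exp (-(π / 2 - 1 / 3 + n * (2 * π) + 2 / 3)) ∧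
    1 - Real.exp (-(π / 2 - 1 / 3 + n * (2 * π) + 2 / 3)) < 1 ∧
    1 - (1 - Real.exp (-(π / 2 - 1 / 3 + n * (2 * π)))) ≤
      2 * (1 - (1 - Real.exp (-(π / 2 - 1 / 3 + n * (2 * π) + 2 / 3)))) ∧
    2 * Real.cos (Real.log (1 - (1 - Real.exp (-(π / 2 - 1 / 3 + n * (2 * π) + 2 / 3))))) + 1 <
      2 * Real.cos (Real.log (1 - (1 - Real.exp (-(π / 2 - 1 / 3 + n * (2 * π)))))) := by
  set a : ℝ := π / 2 - 1 / 3 + n * (2 * π) with ha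
  refine ⟨?_, ?_, ?_, ?_⟩
  · have : Real.exp (-(a + 2 / 3)) ≤ Real.exp (-a) := Real.exp_le_exp.2 (by linarith)
    linarith
  · linarith [Real.exp_pos (-(a + 2 / 3))]
  · -- `e^{-a} ≤ 2 e^{-(a+2/3)}` iff `2/3 ≤ log 2`
    have hlog : (2:ℝ) / 3 ≤ Real.log 2 := by linarith [Real.log_two_gt_d9]
    have h2 : Real.exp (2 / 3) ≤ 2 := (Real.le_log_iff_exp_le two_pos).1 hlog
    have h3 : Real.exp (-a) = Real.exp (-(a + 2 / 3)) * Real.exp (2 / 3) := by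
      rw [← Real.exp_add]; ring_nf
    rw [sub_sub_cancel, sub_sub_cancel, h3, mul_comm (2:ℝ)]
    exact mul_le_mul_of_nonneg_left h2 (Real.exp_pos _).le
  · rw [sub_sub_cancel, sub_sub_cancel, Real.log_exp, Real.log_exp, Real.cos_neg, Real.cos_neg]
    have hc1 : Real.cos a = Real.sin (1 / 3) := by
      rw [ha, Real.cos_add_nat_mul_two_pi, Real.cos_pi_div_two_sub]
    have hc2 : Real.cos (a + 2 / 3) = -Real.sin (1 / 3) := by
      have : a + 2 / 3 = 1 / 3 + π / 2 + n * (2 * π) := by rw [ha]; ring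
      rw [this, Real.cos_add_nat_mul_two_pi, Real.cos_add_pi_div_two]
    rw [hc1, hc2]
    have hs : (1:ℝ) / 3 - (1 / 3) ^ 3 / 6 < Real.sin (1 / 3) := Real.sin_gt_sub_cube (by norm_num)
    nlinarith

/-- **`t ↦ 2 cos log(1−t)` is not slowly decreasing at `1` over dyadic windows** (the property
`SlowlyDecreasingAt _ 1` of the line, written inline): with `ε = 1` every late window of
`two_cos_log_window` is violated. [folklore] -/
theorem not_slowlyDecreasing_two_cos_log :
    ¬ (∀ ε : ℝ, 0 < ε → ∃ t₁ : ℝ, t₁ < 1 ∧ ∀ t t' : ℝ, t₁ ≤ t → t ≤ t' → t' < 1 →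
        1 - t ≤ 2 * (1 - t') →
        2 * Real.cos (Real.log (1 - t)) ≤ 2 * Real.cos (Real.log (1 - t')) + ε) := by
  intro h
  obtain ⟨t₁, ht₁, hsd⟩ := h 1 one_pos
  -- a late window start `1 − e^{−aₙ} ≥ t₁`
  have hlim : Tendsto (fun n : ℕ => Real.exp (-(π / 2 - 1 / 3 + n * (2 * π)))) atTop (𝓝 0) := by
    have h1 : Tendsto (fun n : ℕ => π / 2 - 1 / 3 + (n : ℝ) * (2 * π)) atTop atTop :=
      tendsto_atTop_add_const_left _ _ (tendsto_natCast_atTop_atTop.atTop_mul_const (by positivity))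
    exact Real.tendsto_exp_neg_atTop_nhds_zero.comp h1
  obtain ⟨n, hn⟩ := (hlim.eventually (eventually_lt_nhds (sub_pos.2 ht₁))).exists
  obtain ⟨h1, h2, h3, h4⟩ := two_cos_log_window n
  have h5 := hsd _ _ (by linarith) h1 h2 h3
  linarith

end Summit.NavierStokesRegularity.NavierStokesRegularity.Theorems.AdaptedFrequencyConverges.Negative

end
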